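import Summits.QuantumFields.QCD.Theorems.SpectralDefectExtinctionWindowExtinctionChessboardDefs
import Literature.MathematicalPhysics.QuantumFieldTheory.LatticeGaugeProofs

/-!
# Crux `WindowExtinction` (stmt-QuantumFields-8964), line `chessboard-cold-cells`:
# the flat-cube event — locality, reflection/translation covariance, measurability, indicators

Support file for stub (S1) `stub_chessboard`.  The flat-cube event `CubeFlat U y θ` of the line's
Defs module sees only the twelve spatial links of its cube (`cubeFlat_congr`), is covariant under the
Osterwalder–Seiler time reflection `GaugeConfig.timeReflect` (`cubeFlat_timeReflect`) and under torus
translations `torusConfigShift` (`cubeFlat_torusConfigShift`), and is MEASURABLE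
(`measurableSet_cubeFlat`, anchored as `cubeFlat_measurableSet`): it is the countable union over the
compact shells `1/(n+1) ≤ ‖v‖ ≤ n+1` of colour fields of the projections, along the shell, of the
closed sub-level sets `{energy ≤ θ · mass}`, hence an `F_σ`.  Plus bookkeeping for complex indicator
observables `χ` under the Wilson measure `μW S β` of `SU(3)` on the odd four-torus.
-/

noncomputable section

namespace Summit.QuantumFields.QCD.Cruxes.WindowExtinction.ChessboardColdCells

open MeasureTheory
open scoped ENNReal BigOperators ComplexConjugate ComplexOrder
open Literature.MathematicalPhysics.QuantumLattice Literature.MathematicalPhysics.QuantumFieldTheory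
  Literature.Probability.LatticeModels

/-! ## §B  Geometry of the flat-cube event: locality, reflection and translation covariance -/

section Geometry

variable {L : ℕ}

/-- The time coordinate of a cube corner is that of its lowest corner. -/
theorem corner_apply_zero (y : TorusSite 4 L) (s : Fin 3 → Fin 2) : corner y s 0 = y 0 := by
  simp [corner, spatialOffset]

/-- The time coordinate of `siteOf t xs` is `t`. -/
theorem siteOf_apply_zero (t : ZMod L) (xs : Fin 3 → ZMod L) : siteOf t xs 0 = t := by
  simp [siteOf]

/-- Every site is `siteOf` of its time and its spatial coordinates. -/
theorem siteOf_self_tail (y : TorusSite 4 L) : siteOf (y 0) (Fin.tail y) = y :=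
  Fin.cons_self_tail y

/-- `siteOf t` is injective. -/
theorem siteOf_injective (t : ZMod L) :
    Function.Injective (siteOf t : (Fin 3 → ZMod L) → TorusSite 4 L) :=
  fun _ _ h => (Fin.cons_injective2 h).2

/-- Corners of a translated cube. -/
theorem corner_sub (y v : TorusSite 4 L) (s : Fin 3 → Fin 2) : corner (y - v) s = corner y s - v := by
  simp only [corner, sub_add_eq_add_sub]

/-- Time reflection of a cube corner. -/
theorem timeReflect_corner (y : TorusSite 4 L) (s : Fin 3 → Fin 2) :
    Site.timeReflect (corner y s) = corner (Site.timeReflect y) s := by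
  funext k
  by_cases hk : k = 0
  · subst hk
    simp [Site.timeReflect, corner, spatialOffset]
  · simp [Site.timeReflect, corner, hk]

/-- Time reflection of `siteOf`. -/
theorem timeReflect_siteOf (t : ZMod L) (xs : Fin 3 → ZMod L) :
    Site.timeReflect (siteOf t xs) = siteOf (1 - t) xs := by
  funext k
  refine Fin.cases ?_ (fun j => ?_) k
  · simp [Site.timeReflect, siteOf]
  · simp [Site.timeReflect, siteOf, Fin.succ_ne_zero]

/-- Time translation of `siteOf`. -/
theorem siteOf_sub_siteOf (t a : ZMod L) (xs : Fin 3 → ZMod L) :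
    siteOf t xs - siteOf a 0 = siteOf (t - a) xs := by
  funext k
  refine Fin.cases ?_ (fun j => ?_) k
  · simp [siteOf]
  · simp [siteOf]

/-- The flat-cube event only sees the twelve spatial links of its cube. -/
theorem cubeFlat_congr {U V : GaugeConfig 4 L SU3} {y y' : TorusSite 4 L} {θ : ℝ}
    (h : ∀ (s : Fin 3 → Fin 2) (i : Fin 3), U (corner y s, i.succ) = V (corner y' s, i.succ)) :
    CubeFlat U y θ ↔ CubeFlat V y' θ := by
  have hE : ∀ v, cubeEnergy U y v = cubeEnergy V y' v := fun v => by
    unfold cubeEnergy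
    simp only [h]
  unfold CubeFlat
  simp only [hE]

/-- Reflection covariance of the flat-cube event. -/
theorem cubeFlat_timeReflect (U : GaugeConfig 4 L SU3) (y : TorusSite 4 L) (θ : ℝ) :
    CubeFlat U.timeReflect y θ ↔ CubeFlat U (Site.timeReflect y) θ :=
  cubeFlat_congr fun s i => by
    simp only [GaugeConfig.timeReflect, Fin.succ_ne_zero, if_false, timeReflect_corner]

/-- Translation covariance of the flat-cube event. -/
theorem cubeFlat_torusConfigShift (v : TorusSite 4 L) (U : GaugeConfig 4 L SU3) (y : TorusSite 4 L)
    (θ : ℝ) : CubeFlat (torusConfigShift v U) y θ ↔ CubeFlat U (y - v) θ :=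
  cubeFlat_congr fun s i => by
    simp only [torusConfigShift_apply, corner_sub]

end Geometry

/-! ## §C  Measurability of the flat-cube event (it is an `F_σ`: projections along compact shells) -/

section Measurability

variable {L : ℕ}

/-- Colour fields on the eight corners of a spatial unit 3-cube. -/
abbrev CubeField : Type := (Fin 3 → Fin 2) → Fin 3 → ℂ

/-- The compact shell `1/(n+1) ≤ ‖v‖ ≤ n + 1` of cube colour fields. -/
def shell (n : ℕ) : Set CubeField := {v | 1 ≤ (n + 1 : ℝ) * ‖v‖ ∧ ‖v‖ ≤ n + 1}

/-- The shells are compact. -/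
theorem isCompact_shell (n : ℕ) : IsCompact (shell n) := by
  refine (isCompact_closedBall (0 : CubeField) (n + 1)).of_isClosed_subset ?_ ?_
  · exact (isClosed_le continuous_const (continuous_const.mul continuous_norm)).inter
      (isClosed_le continuous_norm continuous_const)
  · intro v hv
    simpa [Metric.mem_closedBall, dist_zero_right] using hv.2

/-- Fields in a shell are non-zero. -/
theorem ne_zero_of_mem_shell {n : ℕ} {v : CubeField} (hv : v ∈ shell n) : v ≠ 0 := by
  rintro rfl
  have h := hv.1
  norm_num at h

/-- Every non-zero field lies in some shell. -/
theorem exists_mem_shell {v : CubeField} (hv : v ≠ 0) : ∃ n : ℕ, v ∈ shell n := by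
  have hpos : 0 < ‖v‖ := norm_pos_iff.2 hv
  obtain ⟨n, hn⟩ := exists_nat_ge (max ‖v‖ ‖v‖⁻¹)
  refine ⟨n, ?_, ?_⟩
  · have h1 : ‖v‖⁻¹ ≤ n + 1 := ((le_max_right _ _).trans hn).trans (by linarith)
    calc (1 : ℝ) = ‖v‖⁻¹ * ‖v‖ := by field_simp
      _ ≤ (n + 1) * ‖v‖ := mul_le_mul_of_nonneg_right h1 hpos.le
  · exact ((le_max_left _ _).trans hn).trans (by linarith)

/-- The cube mass is continuous. -/
theorem continuous_cubeMass : Continuous (cubeMass : CubeField → ℝ) := by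
  unfold cubeMass
  exact continuous_finsetSum _ fun s _ => continuous_finsetSum _ fun a _ =>
    ((continuous_apply a).comp (continuous_apply s)).norm.pow 2

/-- The cube energy is jointly continuous in the gauge field and the colour field. -/
theorem continuous_cubeEnergy (y : TorusSite 4 L) :
    Continuous fun p : GaugeConfig 4 L SU3 × CubeField => cubeEnergy p.1 y p.2 := by
  unfold cubeEnergy
  refine continuous_const.mul (continuous_finsetSum _ fun s _ => continuous_finsetSum _ fun i _ => ?_)
  by_cases h : s i = 0
  · simp only [h, ↓reduceIte]
    refine continuous_finsetSum _ fun a _ => (Continuous.sub ?_ ?_).norm.pow 2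
    · exact (continuous_apply a).comp ((continuous_apply s).comp continuous_snd)
    · refine (continuous_apply a).comp (Continuous.matrix_mulVec ?_ ?_)
      · exact (continuous_fundamentalRep (Fin 3)).comp ((continuous_apply _).comp continuous_fst)
      · exact (continuous_apply _).comp continuous_snd
  · simp only [h, ↓reduceIte]
    exact continuous_const

/-- The sub-level set `{energy ≤ θ · mass}` (gauge field × colour field). -/
def sublevel₀ (y : TorusSite 4 L) (θ : ℝ) : Set (GaugeConfig 4 L SU3 × CubeField) :=
  {p | cubeEnergy p.1 y p.2 ≤ θ * cubeMass p.2}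

/-- The sub-level set is closed. -/
theorem isClosed_sublevel₀ (y : TorusSite 4 L) (θ : ℝ) : IsClosed (sublevel₀ y θ) := by
  have h2 : Continuous fun p : GaugeConfig 4 L SU3 × CubeField => cubeMass p.2 :=
    continuous_cubeMass.comp continuous_snd
  exact isClosed_le (continuous_cubeEnergy y) (continuous_const.mul h2)

/-- The inclusion of a shell slice into the product. -/
def shellIncl (n : ℕ) : GaugeConfig 4 L SU3 × shell n → GaugeConfig 4 L SU3 × CubeField :=
  fun q => (q.1, (q.2 : CubeField))

/-- The shell inclusion is continuous. -/
theorem continuous_shellIncl (n : ℕ) : Continuous (shellIncl (L := L) n) :=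
  continuous_fst.prodMk (continuous_subtype_val.comp continuous_snd)

/-- The sub-level set over a shell. -/
def sublevel (y : TorusSite 4 L) (θ : ℝ) (n : ℕ) : Set (GaugeConfig 4 L SU3 × shell n) :=
  shellIncl n ⁻¹' sublevel₀ y θ

/-- The sub-level sets over shells are closed. -/
theorem isClosed_sublevel (y : TorusSite 4 L) (θ : ℝ) (n : ℕ) : IsClosed (sublevel y θ n) :=
  (isClosed_sublevel₀ y θ).preimage (continuous_shellIncl n)

/-- Their projections along the compact shell are closed. -/
theorem isClosed_image_sublevel (y : TorusSite 4 L) (θ : ℝ) (n : ℕ) :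
    IsClosed (Prod.fst '' sublevel y θ n) := by
  haveI : CompactSpace (shell n) := isCompact_iff_compactSpace.mp (isCompact_shell n)
  exact isClosedMap_fst_of_compactSpace _ (isClosed_sublevel y θ n)

/-- The flat-cube event as a countable union of projections. -/
theorem setOf_cubeFlat_eq (y : TorusSite 4 L) (θ : ℝ) :
    {U : GaugeConfig 4 L SU3 | CubeFlat U y θ} = ⋃ n : ℕ, Prod.fst '' sublevel y θ n := by
  ext U
  rw [Set.mem_setOf_eq, Set.mem_iUnion]
  constructor
  · rintro ⟨v, hv0, hE⟩
    obtain ⟨n, hn⟩ := exists_mem_shell hv0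
    exact ⟨n, (U, ⟨v, hn⟩), hE, rfl⟩
  · rintro ⟨n, ⟨U', v⟩, hE, hU⟩
    subst hU
    exact ⟨v, ne_zero_of_mem_shell v.2, hE⟩

/-- **The flat-cube event is measurable** (a countable union over shells of projections, along the
compact shell, of closed sets). -/
theorem measurableSet_cubeFlat [NeZero L] (y : TorusSite 4 L) (θ : ℝ) :
    MeasurableSet {U : GaugeConfig 4 L SU3 | CubeFlat U y θ} := by
  rw [setOf_cubeFlat_eq]
  exact MeasurableSet.iUnion fun n => (isClosed_image_sublevel y θ n).measurableSet

end Measurability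

/-- **The flat-cube event is measurable** (anchor of this support file; see
`measurableSet_cubeFlat`). -/
theorem cubeFlat_measurableSet : ∀ (L : ℕ) [NeZero L] (y : TorusSite 4 L) (θ : ℝ),
    MeasurableSet {U : GaugeConfig 4 L SU3 | CubeFlat U y θ} :=
  fun _ _ y θ => measurableSet_cubeFlat y θ

/-! ## Indicator observables under the Wilson measure of the odd four-torus -/

section Indicators

/-- Spatial patterns: finite sets of spatial positions of the torus of side `2S+1`. -/
abbrev Pattern (S : ℕ) : Type := Finset (Fin 3 → ZMod (2 * S + 1))

/-- The Wilson measure of `SU(3)` on the four-torus of odd side `2S+1`. -/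
abbrev μW (S : ℕ) (β : ℝ) : Measure (GaugeConfig 4 (2 * S + 1) SU3) :=
  wilsonMeasure (d := 4) (L := 2 * S + 1) (fundamentalRep (Fin 3)) β

variable {S : ℕ} {β : ℝ}

/-- The complex indicator of an event. -/
def χ (E : Set (GaugeConfig 4 (2 * S + 1) SU3)) : GaugeConfig 4 (2 * S + 1) SU3 → ℂ :=
  E.indicator fun _ => 1

open scoped Classical in
/-- The indicator, pointwise. -/
theorem χ_apply (E : Set (GaugeConfig 4 (2 * S + 1) SU3)) (U : GaugeConfig 4 (2 * S + 1) SU3) :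
    χ E U = if U ∈ E then 1 else 0 := by
  unfold χ
  rw [Set.indicator_apply]

/-- Indicators of events with equivalent membership agree. -/
theorem χ_congr {E : Set (GaugeConfig 4 (2 * S + 1) SU3)} {U V : GaugeConfig 4 (2 * S + 1) SU3}
    (h : U ∈ E ↔ V ∈ E) : χ E U = χ E V := by
  unfold χ
  by_cases hU : U ∈ E
  · rw [Set.indicator_of_mem hU, Set.indicator_of_mem (h.1 hU)]
  · rw [Set.indicator_of_notMem hU, Set.indicator_of_notMem (fun hV => hU (h.2 hV))]

/-- Indicators are bounded by `1`. -/
theorem norm_χ_le (E : Set (GaugeConfig 4 (2 * S + 1) SU3)) (U : GaugeConfig 4 (2 * S + 1) SU3) :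
    ‖χ E U‖ ≤ 1 := by
  rw [χ_apply]
  split_ifs <;> simp

/-- Indicators of measurable events are measurable. -/
theorem measurable_χ {E : Set (GaugeConfig 4 (2 * S + 1) SU3)} (hE : MeasurableSet E) :
    Measurable (χ E) :=
  measurable_const.indicator hE

/-- The Wilson integral of an indicator is the (real) Wilson measure of the event. -/
theorem integral_χ {E : Set (GaugeConfig 4 (2 * S + 1) SU3)} (hE : MeasurableSet E) :
    ∫ U, χ E U ∂(μW S β) = (((μW S β).real E : ℝ) : ℂ) := by
  unfold χ
  rw [integral_indicator_const _ hE, Complex.real_smul, mul_one]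

/-- Indicators of measurable events are Wilson integrable. -/
theorem integrable_χ {E : Set (GaugeConfig 4 (2 * S + 1) SU3)} (hE : MeasurableSet E) :
    Integrable (χ E) (μW S β) := by
  haveI := isProbabilityMeasure_wilsonMeasure (d := 4) (L := 2 * S + 1) (fundamentalRep (Fin 3))
    (continuous_fundamentalRep (Fin 3)) β
  exact (integrable_const (1 : ℂ)).indicator hE

/-- Additivity of the Bochner integral, four terms. -/
theorem integral_add4 {X : Type*} [MeasurableSpace X] {μ : Measure X} {f₁ f₂ f₃ f₄ : X → ℂ}
    (h₁ : Integrable f₁ μ) (h₂ : Integrable f₂ μ) (h₃ : Integrable f₃ μ) (h₄ : Integrable f₄ μ) :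
    ∫ x, f₁ x + f₂ x + f₃ x + f₄ x ∂μ = ∫ x, f₁ x ∂μ + ∫ x, f₂ x ∂μ + ∫ x, f₃ x ∂μ + ∫ x, f₄ x ∂μ := by
  have h₁₂ : Integrable (fun x => f₁ x + f₂ x) μ := h₁.add h₂
  have h₁₂₃ : Integrable (fun x => f₁ x + f₂ x + f₃ x) μ := h₁₂.add h₃
  rw [integral_add h₁₂₃ h₄, integral_add h₁₂ h₃, integral_add h₁ h₂]

end Indicators

end Summit.QuantumFields.QCD.Cruxes.WindowExtinction.ChessboardColdCells

end
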